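import Summits.NavierStokesRegularity.NavierStokesRegularity.Theorems.TypeICertificateLadderNoTypeIBlowupTypeIMorrey
import Summits.NavierStokesRegularity.NavierStokesRegularity.Theorems.RellichScarTypeIBlowupProfileZoomLimit
import Summits.NavierStokesRegularity.NavierStokesRegularity.Theorems.TerminalTraceTypeITraceScarL3ExtinctApexTopVanishing
import Literature.Analysis.FluidPDE.Seregin2020AncientLimit
import Literature.Analysis.FluidPDE.LocalTypeICongr
import Literature.Analysis.FluidPDE.NSCriticalClosureBesovKatoClass
import Literature.Analysis.FluidPDE.SuitableWeakRescaling
import Literature.Analysis.FluidPDE.SereginSverakPressureDecayBalls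
import Literature.Analysis.FluidPDE.BesovBlowupRigidity

/-!
# Line `extinct-apex` of `TerminalTrace.TypeITraceScarL3` (stmt-NavierStokesRegularity-18385), Stub 2 at
# unit viscosity: a Type-I-in-time blow-up with an `L³` terminal ball at a backward-singular apex zooms
# to an EXTINCT TYPE-I APEX

Route `TerminalTrace` (NavierStokesRegularity), registered skeleton `extinct-apex` (nsreg-p2 g26, sha16
07e82d2c7e70161a), Stub 2 `stub_extinctApex_of_L3trace`.  Seat ns-typeII-p3 g9 (cell ns-regularity-ideate).
This file proves the stub at `ν = 1` with the apex given through `¬ IsBackwardBoundedAt`; the sequel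
`…StubExtinctApexOfL3Trace` normalises the viscosity and lands the registered signature.

* `extinctApex_of_L3trace_unit` — `T > 0`, `(u, p)` classical (`ν = 1`) on `ℝ³ × [0, T)`, Leray–Hopf on
  `[0, T]`, Type-I in time (`IsTypeIBlowup u T`), NOT backward bounded at `(T, x₀)`, and
  `u(T) ∈ L³(B(x₀, ρ))`.  Then there are `(U, P, G, M, C)` with: `(U, P)` a suitable weak solution in every
  parabolic ball `Q(a)` at the space–time origin (Albritton–Barker Def. 2.1), `G` a weak spatial gradient on
  every `Q(a)`, `𝐈(Q(a)) ≤ M` at every scale, the rate `‖U(s, y)‖ ≤ C/√(−s)` (a.e. `y`, every `s < 0`), the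
  WEAK VANISHING AT THE TOP TIME (for every test field `φ` and `ε > 0` some `s₀ < 0` with
  `|∫ ⟪U(s), φ⟫| ≤ ε` for a.e. `s ∈ (s₀, 0)`), and a backward-singular origin.

Proof = the tree's `typeIBlowupProfile_proof` (item 1591 of route RellichScar: Morrey bound of a Type-I
solution `morrey_of_typeI`, the viscosity-normalising zoom at `(T, x₀)` in Albritton–Barker's class with
`𝐈(Q(0, 1/2)) < ⊤` (`exists_zoom_typeIBound_lt_top_of_morrey`), backward-singular origin from
`¬ IsBackwardBoundedAt` (`SereginSverak2002.isBackwardBoundedAt_of_zoom`), the rate on a final window, a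
zoom by `1/2`, the zoom-in extraction `Seregin2020.exists_ancientLimit` (compactness + persistence),
`slab_typeIBound_of_zoomLimit`, `ae_rate_of_zoomLimit`, `exists_rate_profile_repr`), run at the GIVEN apex
`x₀` and keeping the per-ball data of the extraction, PLUS the new conjunct: the mean-free pressure quantity
`D_osc` of the zoom bounds `cknDOsc ρ' (T, x₀) p` at the vertex (scale invariance `cknDOsc_nsZoom`, gauge
invariance `cknDOsc_sub_fun_time`), the `L³` ball gives `r⁻¹ ∫_{B(x₀,r)} |u(T)|² → 0`
(`tendsto_scaledEnergy_zero_of_memLp_three`), and the blow-up limit vanishes weakly at the top by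
`ae_abs_pairing_le_near_top_of_morrey` (tool files `…ExtinctApex{SliceBound,PairingModulus,TopVanishing}`).

WHAT THIS IS NOT: not NS regularity, not item 18385, not Stub 3 (the extinction Liouville theorem, OPEN:
Seregin 2014 p. 127) — Albritton–Barker / Seregin–Šverák bookkeeping for a Type-I-in-time blow-up.
[folklore; AlbrittonBarker2019 §3 Remark 3.2; Seregin2014 §6.6 Prop. 6.20, (6.6.2)–(6.6.3);
SereginSverak2002 §4]
-/

noncomputable section

set_option linter.dupNamespace false

namespace Summit.NavierStokesRegularity.NavierStokesRegularity.Theorems.TypeITraceScarL3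

open MeasureTheory Set Function Filter Topology TopologicalSpace Metric
open Literature.Analysis.FluidPDE Literature.Analysis.FluidPDE.SereginSverak2009
open scoped NNReal ENNReal InnerProductSpace RealInnerProductSpace

/-- **Stub 2 of line `extinct-apex` at unit viscosity.** `T > 0`, `(u, p)` classical on `ℝ³ × [0, T)`
(`ν = 1`) and Leray–Hopf on `[0, T]`, Type-I in time, NOT backward bounded at `(T, x₀)`, with
`u(T) ∈ L³(B(x₀, ρ))`: then there is an extinct Type-I apex `(U, P, G, M, C)` — suitable in every `Q(a)`
with weak gradient `G`, `𝐈(Q(a)) ≤ M`, rate `C/√(−s)` a.e. on every slice, weakly vanishing at the top time,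
backward-singular at the origin (module docstring for the proof).
[folklore; AlbrittonBarker2019 §3; Seregin2014 §6.6; SereginSverak2002 §4] -/
theorem extinctApex_of_L3trace_unit {T : ℝ} (hT : 0 < T)
    {u : ℝ → EuclideanSpace ℝ (Fin 3) → EuclideanSpace ℝ (Fin 3)} {p : ℝ → EuclideanSpace ℝ (Fin 3) → ℝ}
    (hsol : IsClassicalNSSolutionOn (Ico 0 T) 1 0 u p) (hLH : IsLerayHopfOn T 1 0 (u 0) u)
    (hI : IsTypeIBlowup u T) (x₀ : EuclideanSpace ℝ (Fin 3)) (hnotbd : ¬ IsBackwardBoundedAt u T x₀)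
    {ρ : ℝ} (hρ : 0 < ρ) (htr : MemLp (u T) 3 (volume.restrict (ball x₀ ρ))) :
    ∃ (U : ℝ → EuclideanSpace ℝ (Fin 3) → EuclideanSpace ℝ (Fin 3)) (P : ℝ → EuclideanSpace ℝ (Fin 3) → ℝ)
      (G : ℝ → EuclideanSpace ℝ (Fin 3) → EuclideanSpace ℝ (Fin 3) →L[ℝ] EuclideanSpace ℝ (Fin 3))
      (M : ℝ≥0) (C : ℝ),
      (∀ a : ℝ, 0 < a → IsSuitableWeakSolutionInBall a (0 : ℝ × EuclideanSpace ℝ (Fin 3)) U P) ∧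
      (∀ a : ℝ, 0 < a →
        HasWeakSpatialGradientOn (parabolicCylinderOpens a (0 : ℝ × EuclideanSpace ℝ (Fin 3))) U G) ∧
      (∀ a : ℝ, 0 < a → typeIBound (parabolicCylinder a (0 : ℝ × EuclideanSpace ℝ (Fin 3))) U P G ≤ M) ∧
      (∀ s : ℝ, s < 0 → ∀ᵐ y : EuclideanSpace ℝ (Fin 3), ‖U s y‖ ≤ C / Real.sqrt (-s)) ∧
      (∀ φ : EuclideanSpace ℝ (Fin 3) → EuclideanSpace ℝ (Fin 3), ContDiff ℝ (⊤ : ℕ∞) φ →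
        HasCompactSupport φ → ∀ ε : ℝ, 0 < ε →
          ∃ s₀ : ℝ, s₀ < 0 ∧ ∀ᵐ s ∂(volume.restrict (Ioo s₀ 0)), |∫ y, ⟪U s y, φ y⟫| ≤ ε) ∧
      IsBackwardSingularPoint U (0 : ℝ × EuclideanSpace ℝ (Fin 3)) := by
  -- adapted from Summits/…/Theorems/RellichScarTypeIBlowupProfile.lean (`typeIBlowupProfile_proof`)
  -- ## (1) Morrey bound and the viscosity-normalising zoom at the GIVEN apex `x₀`
  obtain ⟨r₀, M₀, T₁, hr₀, hT₁, hMor⟩ := morrey_of_typeI one_pos hT hsol hLH hI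
  obtain ⟨R, α, β, hR, hα, hβ, hβeq, hαeq, hβT, hball, hGv, htypeI⟩ :=
    exists_zoom_typeIBound_lt_top_of_morrey one_pos hT hsol hLH hr₀ hT₁ hMor x₀
  rw [div_one] at hβeq hαeq
  set q : ℝ → EuclideanSpace ℝ (Fin 3) → ℝ :=
    fun t x => p t x - (p t 0 - normalisedPressure (u t) 0) with hq
  set v : ℝ → EuclideanSpace ℝ (Fin 3) → EuclideanSpace ℝ (Fin 3) := α • stPull β R T x₀ u with hv
  set πv : ℝ → EuclideanSpace ℝ (Fin 3) → ℝ := α ^ 2 • stPull β R T x₀ q with hπv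
  set Gv : ℝ → EuclideanSpace ℝ (Fin 3) → EuclideanSpace ℝ (Fin 3) →L[ℝ] EuclideanSpace ℝ (Fin 3) :=
    (α * R) • stPull β R T x₀ (fun t x => fderiv ℝ (u t) x) with hGvdef
  -- ## (2) the origin is a backward singular point of the zoom
  have hsing : IsBackwardSingularPoint v (0 : ℝ × EuclideanSpace ℝ (Fin 3)) := by
    intro r hr
    by_contra hfin
    have hfin' : eLpNorm (uncurry v) ⊤
        (volume.restrict (parabolicCylinder (min r 1) (0 : ℝ × EuclideanSpace ℝ (Fin 3)))) < ⊤ := by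
      refine lt_of_le_of_lt (eLpNorm_mono_measure _ (Measure.restrict_mono ?_ le_rfl))
        (lt_top_iff_ne_top.2 hfin)
      exact SuitableCompactness.parabolicCylinder_zero_mono (le_min hr.le zero_le_one) (min_le_left _ _)
    exact hnotbd (SereginSverak2002.isBackwardBoundedAt_of_zoom hsol x₀ hR hα hβ hβT
      (lt_min hr one_pos) (min_le_right _ _) hfin')
  -- ## (3) the rate of the zoom on a final window
  obtain ⟨C, δ, hC0, hδ, -, hrate⟩ := exists_typeI_rate_window hT hI
  set C₁ : ℝ := α * C / Real.sqrt β with hC₁def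
  have hC₁ : 0 ≤ C₁ := by positivity
  have hratev : ∀ s ∈ Ioo (-(δ / β)) 0, ∀ y, ‖v s y‖ ≤ C₁ / Real.sqrt (-s) := by
    intro s hs y
    have h1 : -δ < β * s := by
      have h := mul_lt_mul_of_pos_left hs.1 hβ
      rwa [mul_neg, mul_div_cancel₀ _ hβ.ne'] at h
    have h2 : β * s < 0 := mul_neg_of_pos_of_neg hβ hs.2
    have hb := hrate (T + β * s) ⟨by linarith, by linarith⟩ (x₀ + R • y)
    have hsq : Real.sqrt (T - (T + β * s)) = Real.sqrt β * Real.sqrt (-s) := by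
      rw [show T - (T + β * s) = β * (-s) by ring, Real.sqrt_mul hβ.le]
    rw [hsq] at hb
    have hpos : 0 < Real.sqrt (-s) := Real.sqrt_pos.2 (by linarith [hs.2])
    have hposβ : 0 < Real.sqrt β := Real.sqrt_pos.2 hβ
    rw [hv, smul_stPull_apply, norm_smul, Real.norm_of_nonneg hα.le, hC₁def]
    rw [div_div, le_div_iff₀ (by positivity)]
    calc α * ‖u (T + β * s) (x₀ + R • y)‖ * (Real.sqrt β * Real.sqrt (-s))
        = α * (Real.sqrt β * Real.sqrt (-s) * ‖u (T + β * s) (x₀ + R • y)‖) := by ring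
      _ ≤ α * C := mul_le_mul_of_nonneg_left hb hα.le
  -- ## (4) the second zoom by `1/2`: the class on `Q(0, 2) ⊇ 𝒞 × (−1, 0)`
  have hc : (0 : ℝ) < 1 / 2 := by norm_num
  set v' : ℝ → EuclideanSpace ℝ (Fin 3) → EuclideanSpace ℝ (Fin 3) :=
    (1 / 2 : ℝ) • stPull ((1 / 2 : ℝ) ^ 2) (1 / 2) (0 : ℝ) (0 : EuclideanSpace ℝ (Fin 3)) v with hv'
  set π' : ℝ → EuclideanSpace ℝ (Fin 3) → ℝ :=
    (1 / 2 : ℝ) ^ 2 • stPull ((1 / 2 : ℝ) ^ 2) (1 / 2) (0 : ℝ) (0 : EuclideanSpace ℝ (Fin 3)) πv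
    with hπ'
  set G' : ℝ → EuclideanSpace ℝ (Fin 3) → EuclideanSpace ℝ (Fin 3) →L[ℝ] EuclideanSpace ℝ (Fin 3) :=
    (1 / 2 : ℝ) ^ 2 • stPull ((1 / 2 : ℝ) ^ 2) (1 / 2) (0 : ℝ) (0 : EuclideanSpace ℝ (Fin 3)) Gv
    with hG'def
  have hball' : IsSuitableWeakSolutionInBall 2 0 v' π' := by
    have h := hball.zoomOut hc
    rwa [show (1 : ℝ) / (1 / 2) = 2 by norm_num] at h
  have hG' : HasWeakSpatialGradientOn
      (parabolicCylinderOpens 2 (0 : ℝ × EuclideanSpace ℝ (Fin 3))) v' G' := by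
    have h := hGv.stRescale (1 / 2 : ℝ) (pow_pos hc 2) hc (0 : ℝ) (0 : EuclideanSpace ℝ (Fin 3))
    have hpre : stPreimage ((1 / 2 : ℝ) ^ 2) (1 / 2) (0 : ℝ) (0 : EuclideanSpace ℝ (Fin 3))
        (parabolicCylinderOpens 1 (0 : ℝ × EuclideanSpace ℝ (Fin 3))) =
        parabolicCylinderOpens 2 (0 : ℝ × EuclideanSpace ℝ (Fin 3)) := by
      apply Opens.ext
      rw [coe_stPreimage, coe_parabolicCylinderOpens, coe_parabolicCylinderOpens,
        stAffine_preimage_parabolicCylinder_zero hc, show (1 : ℝ) / (1 / 2) = 2 by norm_num]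
    rw [hpre, ← sq] at h
    exact h
  have hI' : typeIBound (parabolicCylinder 1 (0 : ℝ × EuclideanSpace ℝ (Fin 3))) v' π' G' < ⊤ := by
    have h := typeIBound_nsZoom hc (0 : ℝ) (0 : EuclideanSpace ℝ (Fin 3))
      (parabolicCylinder (1 / 2) (0 : ℝ × EuclideanSpace ℝ (Fin 3))) v πv Gv
    rw [stAffine_preimage_parabolicCylinder_zero hc, show (1 / 2 : ℝ) / (1 / 2) = 1 by norm_num] at h
    rw [hv', hπ', hG'def, h]
    exact htypeI
  have hsing' : IsBackwardSingularPoint v' (0 : ℝ × EuclideanSpace ℝ (Fin 3)) := by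
    intro r hr
    rw [hv', eLpNorm_top_nsZoom hc, Seregin2020.stAffine_zero_zero_apply_zero,
      hsing ((1 / 2) * r) (by positivity)]
    exact ENNReal.mul_top (by simp)
  have hratev' : ∀ s ∈ Ioo (-((δ / β) / (1 / 2 : ℝ) ^ 2)) 0, ∀ y, ‖v' s y‖ ≤ C₁ / Real.sqrt (-s) :=
    fun s hs y => norm_nsZoom_le_rate hc hratev hs y
  -- ## (5) the inputs of the zoom-in extraction on `𝒞 × (−1, 0) ⊆ Q(0, 2)`
  have hsqrt2 : Real.sqrt 2 ≤ 2 := by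
    rw [Real.sqrt_le_left (by norm_num)]
    norm_num
  have hPQ : parCyl (0 : ℝ × EuclideanSpace ℝ (Fin 3)) 1 ⊆
      parabolicCylinder 2 (0 : ℝ × EuclideanSpace ℝ (Fin 3)) := by
    intro z hz
    obtain ⟨ht, hx⟩ := hz
    have hx' := spaceCyl_subset_ball (0 : EuclideanSpace ℝ (Fin 3)) zero_le_one hx
    rw [mul_one, mem_ball_zero_iff] at hx'
    simp only [Prod.fst_zero, one_pow, zero_sub, mem_Ioo] at ht
    rw [SuitableCompactness.mem_parabolicCylinder_zero]
    exact ⟨⟨by linarith [ht.1], ht.2⟩, lt_of_lt_of_le hx' hsqrt2⟩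
  have hle : parCylOpens (0 : ℝ × EuclideanSpace ℝ (Fin 3)) 1 ≤
      parabolicCylinderOpens 2 (0 : ℝ × EuclideanSpace ℝ (Fin 3)) := fun z hz => hPQ hz
  have hsw3 : IsSuitableWeakSolutionOn (parCylOpens (0 : ℝ × EuclideanSpace ℝ (Fin 3)) 1) 1 0 v' π' :=
    IsSuitableWeakSolutionOn.mono_holds hball'.1 hle
  have hA3 : ∃ Cc : ℝ≥0, ∀ᵐ t ∂(volume.restrict (Ioo (-1 : ℝ) 0)),
      ∫⁻ x in spaceCyl (0 : EuclideanSpace ℝ (Fin 3)) 1, ‖v' t x‖ₑ ^ 2 ≤ Cc := by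
    obtain ⟨Cc, hCc⟩ := hball'.2.1
    refine ⟨Cc, ?_⟩
    have hsub : Ioo (-1 : ℝ) 0 ⊆ Ioo ((0 : ℝ × EuclideanSpace ℝ (Fin 3)).1 - 2 ^ 2)
        (0 : ℝ × EuclideanSpace ℝ (Fin 3)).1 := by
      intro t ht
      simp only [Prod.fst_zero, zero_sub, mem_Ioo]
      exact ⟨by linarith [ht.1], ht.2⟩
    have hballsub : spaceCyl (0 : EuclideanSpace ℝ (Fin 3)) 1 ⊆
        ball (0 : ℝ × EuclideanSpace ℝ (Fin 3)).2 2 := by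
      refine (spaceCyl_subset_ball (0 : EuclideanSpace ℝ (Fin 3)) zero_le_one).trans ?_
      rw [mul_one, Prod.snd_zero]
      exact ball_subset_ball hsqrt2
    filter_upwards [ae_restrict_of_ae_restrict_of_subset hsub hCc] with t ht
    exact (lintegral_mono_set hballsub).trans ht
  have hG3 : HasWeakSpatialGradientOn (parCylOpens (0 : ℝ × EuclideanSpace ℝ (Fin 3)) 1) v' G' :=
    hG'.mono hle
  have hE3 : ∫⁻ z in parCyl (0 : ℝ × EuclideanSpace ℝ (Fin 3)) 1,
      ENNReal.ofReal (frobeniusNormSq (G' z.1 z.2)) < ⊤ := by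
    obtain ⟨G'', hG'', hG''2⟩ := hball'.2.2.1
    have hae := hG'.ae_eq hG''
    rw [coe_parabolicCylinderOpens] at hae
    refine lt_of_le_of_lt (lintegral_mono_set hPQ) ?_
    have e : ∫⁻ z in parabolicCylinder 2 (0 : ℝ × EuclideanSpace ℝ (Fin 3)),
        ENNReal.ofReal (frobeniusNormSq (G' z.1 z.2)) =
        ∫⁻ z in parabolicCylinder 2 (0 : ℝ × EuclideanSpace ℝ (Fin 3)),
        ENNReal.ofReal (frobeniusNormSq (G'' z.1 z.2)) := by
      refine lintegral_congr_ae ?_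
      filter_upwards [hae] with z hz
      have hz' : G' z.1 z.2 = G'' z.1 z.2 := hz
      rw [hz']
    rw [e]
    exact hG''2
  have hp3 : ∫⁻ z in parCyl (0 : ℝ × EuclideanSpace ℝ (Fin 3)) 1,
      ‖π' z.1 z.2‖ₑ ^ (3 / 2 : ℝ) < ⊤ := by
    obtain ⟨h32, h32', h32r⟩ := threeHalves_facts
    have hm : MemLp (uncurry π') (3 / 2)
        (volume.restrict (parabolicCylinder 2 (0 : ℝ × EuclideanSpace ℝ (Fin 3)))) := hball'.2.2.2
    have h2 := hm.2
    rw [eLpNorm_eq_lintegral_rpow_enorm_toReal (by norm_num) h32', h32r] at h2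
    have hfin : ∫⁻ z in parabolicCylinder 2 (0 : ℝ × EuclideanSpace ℝ (Fin 3)),
        ‖uncurry π' z‖ₑ ^ (3 / 2 : ℝ) < ⊤ := by
      by_contra htop
      rw [not_lt, top_le_iff] at htop
      rw [htop, ENNReal.top_rpow_of_pos (by norm_num)] at h2
      exact lt_irrefl _ h2
    exact lt_of_le_of_lt (lintegral_mono_set hPQ) hfin
  have hI3 : Seregin2020.blowupIndex 0 v' G' < ⊤ := by
    refine lt_of_le_of_lt (Seregin2020.blowupIndex_le_limsup_cknC 0 v' G') (lt_of_le_of_lt ?_ hI')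
    refine limsup_le_of_le (by isBoundedDefault) ?_
    filter_upwards [Ioo_mem_nhdsGT (zero_lt_one' ℝ)] with r hr
    exact cknC_le_abScaledSum.trans (abScaledSum_le_typeIBound hr.1
      (SuitableCompactness.parabolicCylinder_zero_mono hr.1.le hr.2.le))
  -- ## (6) the zoom-in limit at the singular origin
  obtain ⟨K, κ, lam, w, ϖ, -, hlam, hlam0, hsingw, hlimw⟩ :=
    Seregin2020.exists_ancientLimit hsw3 hA3 hG3 hE3 hp3 hsing' hI3
  -- ## (7) the slab class with `𝐈 ≤ 4 𝐈(Q(0,1))`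
  have hball1 : IsSuitableWeakSolutionInBall 1 0 v' π' :=
    SuitableCompactness.isSuitableWeakSolutionInBall_of_le_radius hball' (by norm_num) (by norm_num)
  have hG1 : HasWeakSpatialGradientOn
      (parabolicCylinderOpens 1 (0 : ℝ × EuclideanSpace ℝ (Fin 3))) v' G' :=
    hG'.mono (SuitableCompactness.parabolicCylinderOpens_zero_mono (by norm_num) (by norm_num))
  obtain ⟨hsww, H, hH, h4I⟩ := slab_typeIBound_of_zoomLimit
    (typeIBound (parabolicCylinder 1 (0 : ℝ × EuclideanSpace ℝ (Fin 3))) v' π' G') hI' one_pos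
    hball1 hG1 le_rfl hlam hlam0
    (fun a ha => ⟨(hlimw a ha).1, (hlimw a ha).2.1, (hlimw a ha).2.2.1, (hlimw a ha).2.2.2.1⟩)
  -- ## (8) the rate, almost everywhere on the slab
  have hvm : ∀ a : ℝ, 0 < a → ∀ᶠ j in atTop, AEStronglyMeasurable
      (uncurry ((lam j) • stPull ((lam j) ^ 2) (lam j) (0 : ℝ) (0 : EuclideanSpace ℝ (Fin 3)) v'))
      (volume.restrict (parabolicCylinder a (0 : ℝ × EuclideanSpace ℝ (Fin 3)))) := by
    intro a ha
    have hev : ∀ᶠ j in atTop, lam j < 1 / a := hlam0 (Iio_mem_nhds (by positivity))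
    filter_upwards [hev] with j hj
    have hμ := hlam j
    have h := hG1.stRescale (lam j) (pow_pos hμ 2) hμ (0 : ℝ) (0 : EuclideanSpace ℝ (Fin 3))
    have hsub : parabolicCylinder a (0 : ℝ × EuclideanSpace ℝ (Fin 3)) ⊆
        ((stPreimage ((lam j) ^ 2) (lam j) (0 : ℝ) (0 : EuclideanSpace ℝ (Fin 3))
          (parabolicCylinderOpens 1 (0 : ℝ × EuclideanSpace ℝ (Fin 3))) :
            Opens (ℝ × EuclideanSpace ℝ (Fin 3))) : Set (ℝ × EuclideanSpace ℝ (Fin 3))) := by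
      rw [coe_stPreimage, coe_parabolicCylinderOpens, stAffine_preimage_parabolicCylinder_zero hμ]
      refine SuitableCompactness.parabolicCylinder_zero_mono ha.le ?_
      rw [le_div_iff₀ hμ, mul_comm]
      exact ((lt_div_iff₀ ha).1 hj).le
    exact h.locallyIntegrableOn.aestronglyMeasurable.mono_measure (Measure.restrict_mono hsub le_rfl)
  have hae_rate := ae_rate_of_zoomLimit (by positivity : (0 : ℝ) < (δ / β) / (1 / 2 : ℝ) ^ 2)
    hratev' hlam hlam0 hvm (fun a ha => ⟨(hlimw a ha).2.1.1, (hlimw a ha).2.2.1⟩)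
  -- ## (9) a representative with the pointwise rate
  have h4top : typeIBound (Iio (0 : ℝ) ×ˢ univ) w ϖ H < ⊤ :=
    lt_of_le_of_lt h4I (ENNReal.mul_lt_top (by simp) hI')
  obtain ⟨w', haew, hsw', hwg', hIw', hdec', hsing''⟩ :=
    exists_rate_profile_repr hC₁ hsww hH h4top hsingw hae_rate
  -- ## (10) NEW: the mean-free pressure quantity at the vertex is bounded (scale + gauge invariance)
  set I₀ : ℝ≥0 := (typeIBound (parabolicCylinder (1 / 2) (0 : ℝ × EuclideanSpace ℝ (Fin 3))) v πv Gv).toNNReal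
    with hI₀
  have hI₀eq : ((I₀ : ℝ≥0) : ℝ≥0∞) =
      typeIBound (parabolicCylinder (1 / 2) (0 : ℝ × EuclideanSpace ℝ (Fin 3))) v πv Gv :=
    ENNReal.coe_toNNReal htypeI.ne
  have hD : ∀ ρ' : ℝ, 0 < ρ' → ρ' ≤ R / 2 → cknDOsc ρ' ((T : ℝ), x₀) p ≤ I₀ := by
    intro ρ' hρ' hρ'R
    -- the radius in zoomed variables
    set r : ℝ := ρ' / R with hr
    have hr0 : 0 < r := by positivity
    have hrhalf : r ≤ 1 / 2 := by
      rw [hr, div_le_iff₀ hR]; linarith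
    have hRr : R * r = ρ' := by rw [hr]; field_simp
    -- `D_osc` of the zoom on `Q(0, r)` is at most `𝐈(Q(0, 1/2))`
    have h1 : cknDOsc r (0 : ℝ × EuclideanSpace ℝ (Fin 3)) πv ≤ I₀ := by
      rw [hI₀eq]
      refine le_trans ?_ (abScaledSum_le_typeIBound (u := v) (p := πv) (G := Gv) hr0
        (SuitableCompactness.parabolicCylinder_zero_mono hr0.le hrhalf))
      unfold abScaledSum
      exact le_add_right (le_add_left le_rfl)
    -- scale invariance: it is `D_osc` of the gauged pressure on `Q_{ρ'}(T, x₀)`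
    have h2 : cknDOsc r (0 : ℝ × EuclideanSpace ℝ (Fin 3)) πv = cknDOsc ρ' ((T : ℝ), x₀) q := by
      have h := cknDOsc_nsZoom hR hr0 T x₀ (0 : ℝ × EuclideanSpace ℝ (Fin 3)) q
      rw [hπv, hαeq, hβeq]
      rw [h, hRr]
      congr 1
      ext <;> simp [stAffine]
    -- gauge invariance: a function of time does not change `D_osc`
    have h3 : cknDOsc ρ' ((T : ℝ), x₀) q = cknDOsc ρ' ((T : ℝ), x₀) p := by
      refine cknDOsc_sub_fun_time hρ' (fun t => p t 0 - normalisedPressure (u t) 0) ?_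
      refine (ae_restrict_mem measurableSet_Ioo).mono fun t ht => ?_
      have hρ'2 : ρ' ^ 2 ≤ T := by
        have h1' : ρ' ≤ R := by linarith
        have : ρ' ^ 2 ≤ R ^ 2 := pow_le_pow_left₀ hρ'.le h1' 2
        rw [← hβeq] at this
        exact this.trans hβT
      have htI : t ∈ Ico 0 T := ⟨by simp only at ht; linarith [ht.1], ht.2⟩
      exact ((hsol.contDiff_pressure htI).continuous.continuousOn.integrableOn_compact
        (isCompact_closedBall _ _)).mono_set ball_subset_closedBall
    rw [← h3, ← h2]
    exact h1
  -- ## (11) NEW: the final value has no scaled-energy concentration at `x₀` (the `L³` ball)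
  have hFE := tendsto_scaledEnergy_zero_of_memLp_three hρ htr
  -- ## (12) NEW: the zoom sequence as pure parabolic zooms of `u` at `(T, x₀)`
  have hv1 : v = R • stPull (R ^ 2) R T x₀ u := by rw [hv, hαeq, hβeq]
  set Rj : ℕ → ℝ := fun j => lam j * (1 / 2 * R) with hRj
  have hRjpos : ∀ j, 0 < Rj j := fun j =>
    show 0 < lam j * (1 / 2 * R) from mul_pos (hlam j) (by positivity)
  have hRj0 : Tendsto Rj atTop (𝓝 0) := by
    have := hlam0.mul_const (1 / 2 * R)
    rwa [zero_mul] at this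
  have hzoomj : ∀ j, (lam j) • stPull ((lam j) ^ 2) (lam j) (0 : ℝ) (0 : EuclideanSpace ℝ (Fin 3)) v' =
      (Rj j) • stPull ((Rj j) ^ 2) (Rj j) T x₀ u := by
    intro j
    rw [hv', hv1, zoom_zoom_velocity, zoom_zoom_velocity]
    simp only [hRj, mul_assoc]
  have hMor₀ : ∀ t ∈ Ioo T₁ T, ∀ ρ' : ℝ, 0 < ρ' → ρ' ≤ r₀ →
      ∫ x in ball x₀ ρ', ‖u t x‖ ^ 2 ≤ M₀ * ρ' := fun t ht ρ' hρ' hρ'r => hMor t ht x₀ ρ' hρ' hρ'r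
  -- ## (13) NEW: the weak vanishing of `w` at the top time
  have htop_w : ∀ φ : EuclideanSpace ℝ (Fin 3) → EuclideanSpace ℝ (Fin 3), ContDiff ℝ (⊤ : ℕ∞) φ →
      HasCompactSupport φ → ∀ ε : ℝ, 0 < ε →
        ∃ δ' > 0, ∀ᵐ s ∂(volume : Measure ℝ), s ∈ Ioo (-δ') 0 → |∫ y, ⟪w s y, φ y⟫| ≤ ε := by
    intro φ hφ hφc ε hε
    obtain ⟨Rφ, hRφ⟩ := hφc.isCompact.isBounded.subset_closedBall (0 : EuclideanSpace ℝ (Fin 3))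
    set a : ℝ := max 1 (Rφ + 1) with hadef
    have ha1 : 1 ≤ a := le_max_left _ _
    have ha : 0 < a := one_pos.trans_le ha1
    have hφa : tsupport φ ⊆ ball (0 : EuclideanSpace ℝ (Fin 3)) a := fun x hx =>
      (closedBall_subset_ball (by rw [hadef]; exact lt_of_lt_of_le (by linarith) (le_max_right _ _))) (hRφ hx)
    have hw3 := (hlimw a ha).2.1
    have hconv := (hlimw a ha).2.2.1
    simp only [hzoomj] at hconv
    exact ae_abs_pairing_le_near_top_of_morrey hT hsol hLH x₀ hr₀ hT₁ hMor₀ (by positivity : 0 < R / 2) hD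
      hFE hRjpos hRj0 ha1 hw3 hconv hφ hφc hφa hε
  -- ## (14) transfer to the representative `w'` and assemble
  have hQslab : ∀ a : ℝ, parabolicCylinder a (0 : ℝ × EuclideanSpace ℝ (Fin 3)) ⊆
      Iio (0 : ℝ) ×ˢ (univ : Set (EuclideanSpace ℝ (Fin 3))) := fun a => parabolicCylinder_origin_subset_slab a
  have hQle : ∀ a : ℝ, parabolicCylinderOpens a (0 : ℝ × EuclideanSpace ℝ (Fin 3)) ≤
      slab (EuclideanSpace ℝ (Fin 3)) (Iio 0) isOpen_Iio := by
    intro a z hz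
    show z ∈ ((slab (EuclideanSpace ℝ (Fin 3)) (Iio 0) isOpen_Iio : Opens (ℝ × EuclideanSpace ℝ (Fin 3))) :
      Set (ℝ × EuclideanSpace ℝ (Fin 3)))
    rw [coe_slab]
    exact hQslab a hz
  set M : ℝ≥0 := (typeIBound (Iio (0 : ℝ) ×ˢ univ) w' ϖ H).toNNReal with hM
  have hMeq : ((M : ℝ≥0) : ℝ≥0∞) = typeIBound (Iio (0 : ℝ) ×ˢ univ) w' ϖ H := ENNReal.coe_toNNReal hIw'.ne
  -- slices of `w'` agree with those of `w` at a.e. time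
  have hslice : ∀ᵐ s ∂(volume.restrict (Iio (0 : ℝ))), ∀ᵐ y : EuclideanSpace ℝ (Fin 3), w s y = w' s y := by
    have h1 : ∀ᵐ z ∂((volume.restrict (Iio (0 : ℝ))).prod (volume : Measure (EuclideanSpace ℝ (Fin 3)))),
        uncurry w z = uncurry w' z := by
      rw [← Measure.restrict_univ (μ := (volume : Measure (EuclideanSpace ℝ (Fin 3)))),
        Measure.prod_restrict, ← Measure.volume_eq_prod]
      exact haew
    exact Measure.ae_ae_of_ae_prod h1
  refine ⟨w', ϖ, H, M, C₁, ?_, ?_, ?_, ?_, ?_, hsing''⟩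
  · -- suitable in every ball: a.e. modification of `w`
    intro a ha
    exact (hlimw a ha).1.congr_ae' (ae_restrict_of_ae_restrict_of_subset (hQslab a) haew)
      (ae_of_all _ fun _ => rfl)
  · intro a _
    exact hwg'.mono (hQle a)
  · intro a _
    rw [hMeq]
    exact typeIBound_mono (hQslab a)
  · intro s hs
    exact ae_of_all _ fun y => hdec' s hs y
  · intro φ hφ hφc ε hε
    obtain ⟨δ', hδ', hw⟩ := htop_w φ hφ hφc ε hε
    refine ⟨-δ', by linarith, ?_⟩
    have hw_r : ∀ᵐ s ∂(volume.restrict (Ioo (-δ') 0)), |∫ y, ⟪w s y, φ y⟫| ≤ ε :=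
      (ae_restrict_iff' measurableSet_Ioo).2 hw
    have hsl_r : ∀ᵐ s ∂(volume.restrict (Ioo (-δ') 0)),
        ∀ᵐ y : EuclideanSpace ℝ (Fin 3), w s y = w' s y :=
      ae_restrict_of_ae_restrict_of_subset Ioo_subset_Iio_self hslice
    filter_upwards [hw_r, hsl_r] with s hs hsl
    have e : ∫ y, ⟪w' s y, φ y⟫ = ∫ y, ⟪w s y, φ y⟫ :=
      integral_congr_ae (hsl.mono fun y hy => by simp only [hy])
    rw [e]
    exact hs

end Summit.NavierStokesRegularity.NavierStokesRegularity.Theorems.TypeITraceScarL3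

end
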